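import Summits.RiemannHypothesis.RiemannHypothesis.Theorems.ThetaTier2RowSound
import HarnessLib

/-!
# THETA tier-2 kernel rows — twin primes `1997 ≤ q ≤ 2687` (module 4 of 13; cc-s2-1, WEIL typing lane; RH-FREE bookkeeping)

Data module of the tier-2 theta certificate (THETA-CERT-cc6 §E; HOME/cc-s2-1/gen22/TIER2-KERNEL-SPEC.md; soundness chain
`ThetaTier2Check … ThetaTier2RowSound`): the rows `(q, q⁺, m, δ·10¹², menu, k)` — `m = 5`, `δ = ⌊0.98·δ_q·10¹²⌋/10¹²` with
`δ_q = ½ log(q⁺/q)`, menu `0` = thin seed `(1/20, 19/20, 1)`, `η′ = 1/100` (menu `1` = `(1/4, 3/5, 1)`, `η′ = 1/20` for `q = 179, 191`),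
`t₀ = 2⁻¹⁵`; `K = 6`, `τ = 1/100`, `D = 3`, `W_l = 4`, `J = 64` — for the twin primes `1997 ≤ q ≤ 2687` in the range of the route item
`stmt-RiemannHypothesis-19172` (`WallsTenKTwin`, `route-RiemannHypothesis-WeilSemilocal`), checked in the kernel by `Row2.check`
(`decide +kernel`, ≈ 14 s per row), and the resulting REAL statements `T2Valid r.inp r.real ∧ r.RowFacts` (`Row2.check_sound`) that the
E-side assembly turns into `UC(q)`.  Nothing here bears on the truth of RH.
-/

set_option linter.dupNamespace false  -- the mandated namespace repeats `RiemannHypothesis`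

namespace Summit.RiemannHypothesis.RiemannHypothesis.Theorems.ThetaTier2

/-- Twin rows `1997 ≤ q ≤ 2237` (8 rows). [this cell, TIER2-KERNEL-SPEC §4] -/
def twinRows04_1 : List Row2 := [
  ⟨1997, 1999, 5, 490490531, 0, 15⟩, ⟨2027, 2029, 5, 483234753, 0, 15⟩, ⟨2081, 2083, 5, 470701284, 0, 15⟩, ⟨2087, 2089, 5, 469348694, 0, 15⟩,
  ⟨2111, 2113, 5, 464015186, 0, 15⟩, ⟨2129, 2131, 5, 460093930, 0, 15⟩, ⟨2141, 2143, 5, 457516373, 0, 15⟩, ⟨2237, 2239, 5, 437891003, 0, 15⟩ ]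

/-- The kernel verdict for `twinRows04_1`. [this cell, THETA-CERT-cc6 §E6] -/
theorem twinRows04_1_check : twinRows04_1.all Row2.check = true := by
  decide +kernel

/-- (K1)–(K7) and the row facts at every row of `twinRows04_1`. [this cell, THETA-CERT-cc6 §E6] -/
theorem twinRows04_1_valid : ∀ r ∈ twinRows04_1, T2Valid r.inp r.real ∧ r.RowFacts :=
  fun r hr => r.check_sound (List.all_eq_true.1 twinRows04_1_check r hr)

/-- Twin rows `2267 ≤ q ≤ 2687` (8 rows). [this cell, TIER2-KERNEL-SPEC §4] -/
def twinRows04_2 : List Row2 := [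
  ⟨2267, 2269, 5, 432098793, 0, 15⟩, ⟨2309, 2311, 5, 424242450, 0, 15⟩, ⟨2339, 2341, 5, 418803444, 0, 15⟩, ⟨2381, 2383, 5, 411418999, 0, 15⟩,
  ⟨2549, 2551, 5, 384313745, 0, 15⟩, ⟨2591, 2593, 5, 378086438, 0, 15⟩, ⟨2657, 2659, 5, 368698286, 0, 15⟩, ⟨2687, 2689, 5, 364583350, 0, 15⟩ ]

/-- The kernel verdict for `twinRows04_2`. [this cell, THETA-CERT-cc6 §E6] -/
theorem twinRows04_2_check : twinRows04_2.all Row2.check = true := by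
  decide +kernel

/-- (K1)–(K7) and the row facts at every row of `twinRows04_2`. [this cell, THETA-CERT-cc6 §E6] -/
theorem twinRows04_2_valid : ∀ r ∈ twinRows04_2, T2Valid r.inp r.real ∧ r.RowFacts :=
  fun r hr => r.check_sound (List.all_eq_true.1 twinRows04_2_check r hr)

end Summit.RiemannHypothesis.RiemannHypothesis.Theorems.ThetaTier2
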